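import Summits.Ventures.HSemireg.AmplificationChainSigmaGluable
import Literature.AlgebraicGeometry.HodgeTheory.TwistedReflexiveClassOfSchemeIso
import Literature.Algebra.Homology.DerivedCategoryMapEquivalence
import Mathlib.LinearAlgebra.Dimension.Finite
import HarnessLib

/-!
# Venture HSemireg — the gluable σ-notion along an isomorphism of the base scheme: the `Ext^{<0} = 0` clause
# and the strictly-perfect data TRANSPORT (proved); the notion's pull-back invariance REDUCED to the one σ_q-level
# statement `IsISemiregularC` along `e^*`

research route conditional on HC_CM; not a corollary; Q11.4-sentence-2 already refuted in dim ≥ 3.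

HONEST FRAMING. Kernel bookkeeping for road b02 (`VHCAbelianSchemesRoad`, crux `SemiregularSheafRepresentativesTwAtDiag`,
stmt-HodgeConjecture-19787), item (B) of ring2 LEAD gen 151 (HOME INBOX 2026-08-27 l.4967) = the «σ-STACK HALF» complementary to
ring2-b02 gen 87's D1/D2 (`HodgeTheory/TwistedReflexiveClassOfSchemeIso`, `Theorems/VHCAbelianSchemesRoadTwistedDoorIso`): D2's
`twistedDoor_respectsIso_of_sigmaPullback` reduces the displayed `h𝒪`/`hresp`/`htr` hypotheses of the twisted door
`AdmTw = gluableSigmaAdmissible ∨ bfSingleAdmissible` to ONE notion-level statement `hσ` — pull-back invariance of §1's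
`gluableSigmaAdmissible` (`AmplificationChainSigmaGluable.lean`) along isomorphisms `e : Y' ≅ Y` of `ℂ`-schemes. The notion has
three conjuncts: (i) `{1..n} ⊆ I`; (ii) `Ext^{k}_{D(Y)}(E, E) = 0` for `k < 0` (`extRank`); (iii) `E ∈ [a, b]` termwise finite locally
free with `(σ_q)_{q+1 ∈ I}` jointly injective (`HomComplex.IsISemiregularC`). THIS FILE PROVES the transport of (ii) and of the
data of (iii), and REDUCES `hσ` to the transport of the joint injectivity ALONE:

* §1 `isEquivalence_pullback_left` — `e^*` is an equivalence of module categories (left adjoint of the equivalence `e_*`);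
  `extRank_pullback_eq_zero_iff` — **`extRank Y' (e^* E) n = 0 ↔ extRank Y E n = 0`** for every `n : ℤ`: `D(e^*)` is an
  equivalence of derived categories (the tree's `Literature.Algebra.Homology.mapDerivedCategory_isEquivalence`, new) so
  `Hom_{D(Y')}(Q e^*E, (Q e^*E)⟦n⟧) ≃ Hom_{D(Y)}(Q E, (Q E)⟦n⟧)`; hence `extRank_neg_vanish_pullback` — clause (ii) transports.
  (Equality of all `extRank`s needs `ℂ`-linearity of `e^*` for the tree's `instLinearOverBase`, not in the tree; not needed here.)
* §2 **`gluableSigmaAdmissible.pullback_of_schemeIso_of_isISemiregularC`** (pointwise) and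
  **`gluableSigmaAdmissible_pullback_of_schemeIso_of_isISemiregularC`** (the displayed shape, VERBATIM the `hσ` of D2 as
  conclusion): the notion transports along `e` AS SOON AS `IsISemiregularC` does — hypothesis `hσC`, stated as the exact signature
  of the missing theorem `HomComplex.IsISemiregularC.of_schemeIso` (pull-back form: `IsISemiregularC Y E a b hE J →
  IsISemiregularC Y' (e^* E) a b (e^* hE) J`). The amplitude `[a, b]` and termwise local freeness of `e^* E` are automatic
  (Mathlib `map_isStrictlySupported`, the tree's `IsFiniteLocallyFree.pullback`).

WHAT REMAINS (named, not hidden): `hσC` = the naturality of the cell's `σ_q = Q(unit) ≫ Φ_K(x·ι•·At(K•)^q) ≫ Q(Tr•)⟦q+2⟧`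
(`HodgeTheory/HomComplexSigma.lean`) under `e^*` — the complex-level twin of the tree's module-level
`IsISemiregular.of_schemeIso` (`HodgeTheory/ISemiregularOfSchemeIso.lean`, via `TwistJetPushforwardIso` / `PushforwardIsoContract`
/ `AtiyahClassTraceNaturality`): it needs `𝓗om•(e^*K, e^*–) ≅ e^* 𝓗om•(K, –)` on total complexes, the complex Atiyah class
`extMulAtiyahPower` and the supertrace `supertraceH` along `e^*`, and the compatibility of `derivedLift`/`shiftedHomMap` with
`D(e^*)` — none in the tree today (ring2-b02 gen 87 census (iii), confirmed). Nothing here asserts that statement.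

NOT here: any object, any σ-rank, any door word; no skeleton / route change; no `instance`, no axiom, no Literature fact; HC_CM,
HC_AV, HC nowhere.

References: [Lieblich2006] J. Algebraic Geom. 15 (2006), Prop. 2.1.9 (universally gluable: `Ext^{<0} = 0`) · [BuchweitzFlenner2003]
Compositio Math. 137 (2003), Def. 4.1, §5 (I-semiregular) · [Weibel1994] §10.4, Cor. 10.4.7 · [Hartshorne1977] II §5 p. 110
(`f^* ⊣ f_*`).
-/

noncomputable section

open CategoryTheory CategoryTheory.Limits AlgebraicGeometry
open AlgebraicGeometry.Scheme.Modules
open Literature.AlgebraicGeometry Literature.AlgebraicGeometry.Motives Literature.AlgebraicGeometry.Modules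
open Literature.AlgebraicGeometry.HodgeTheory Literature.AlgebraicGeometry.KTheory

namespace Summit.Ventures.HSemireg

/-! ## §1 `e^*` is an equivalence; the `Ext^{<0} = 0` clause transports -/

section ExtClause

variable {Y Y' : SchemeOver ℂ} (e : Y' ≅ Y)

/-- **`e^*` is an equivalence of categories `Mod 𝒪_Y ≌ Mod 𝒪_{Y'}`** for an isomorphism `e : Y' ≅ Y` of `ℂ`-schemes: the left
adjoint (Mathlib `pullbackPushforwardAdjunction`) of the equivalence `e_*` (the tree's `isEquivalence_pushforward_left`).
[cite: Hartshorne1977, II §5 p. 110 (f^* ⊣ f_*)] -/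
theorem isEquivalence_pullback_left : (Scheme.Modules.pullback e.hom.left).IsEquivalence :=
  (Scheme.Modules.pullbackPushforwardAdjunction e.hom.left).isEquivalence_left_of_isEquivalence_right

/-- **The `Ext`-ranks of `e^* E` vanish exactly where those of `E` do**: `extRank Y' (e^* E) n = 0 ↔ extRank Y E n = 0` for
every `n : ℤ` — `D(e^*) : D(Mod 𝒪_Y) ⥤ D(Mod 𝒪_{Y'})` is an equivalence (`mapDerivedCategory_isEquivalence`), so
`Hom(Q e^*E, (Q e^*E)⟦n⟧) ≃ Hom(Q E, (Q E)⟦n⟧)` (`subsingleton_shiftHom_iff`), and a `ℂ`-vector space has rank `0` iff it is a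
subsingleton. [cite: Weibel1994, §10.4 and Cor. 10.4.7] [cite: Lieblich2006, Prop. 2.1.9 (Ext^{<0} = 0)] -/
theorem extRank_pullback_eq_zero_iff (E : CochainComplex Y.left.Modules ℤ) (n : ℤ) :
    extRank Y' (((Scheme.Modules.pullback e.hom.left).mapHomologicalComplex _).obj E) n = 0 ↔ extRank Y E n = 0 := by
  letI := HasDerivedCategory.standard Y.left.Modules
  letI := HasDerivedCategory.standard Y'.left.Modules
  haveI := isEquivalence_pullback_left e
  unfold extRank
  rw [rank_zero_iff, rank_zero_iff]
  exact Literature.Algebra.Homology.subsingleton_shiftHom_iff (Scheme.Modules.pullback e.hom.left) E E n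

/-- **Clause (ii) of the gluable σ-notion transports along `e^*`**: if `Ext^{k}_{D(Y)}(E, E) = 0` for all `k < 0` then
`Ext^{k}_{D(Y')}(e^* E, e^* E) = 0` for all `k < 0` (Lieblich's universal gluability is a property of the isomorphism class
of `(Y, E)`). [cite: Lieblich2006, Prop. 2.1.9 (universally gluable)] -/
theorem extRank_neg_vanish_pullback (E : CochainComplex Y.left.Modules ℤ) (h : ∀ k : ℤ, k < 0 → extRank Y E k = 0) :
    ∀ k : ℤ, k < 0 → extRank Y' (((Scheme.Modules.pullback e.hom.left).mapHomologicalComplex _).obj E) k = 0 :=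
  fun k hk => (extRank_pullback_eq_zero_iff e E k).2 (h k hk)

end ExtClause

/-! ## §2 The notion transports as soon as `IsISemiregularC` does -/

section Reduction

variable {Y Y' : SchemeOver ℂ}

/-- **`gluableSigmaAdmissible` transports along an isomorphism `e : Y' ≅ Y` of `ℂ`-schemes as soon as the joint injectivity
`IsISemiregularC` of `(σ_q)_{q+1 ∈ I}` does** (pointwise form): given the σ_q-transport `hσC` for the complex `E` in its
strictly-perfect presentation `[a, b]`, `hE`, the pulled-back complex `e^* E` is gluable-σ-admissible — clause (i) is unchanged,
clause (ii) by `extRank_neg_vanish_pullback`, the amplitude and local freeness of `e^* E` are automatic.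
[cite: BuchweitzFlenner2003, §5 (I-semiregular)] [cite: Lieblich2006, Prop. 2.1.9] -/
theorem gluableSigmaAdmissible.pullback_of_schemeIso_of_isISemiregularC (e : Y' ≅ Y) {n : ℕ} {I : Finset ℕ}
    {E : CochainComplex Y.left.Modules ℤ}
    (hσC : ∀ (a b : ℤ) [E.IsStrictlyGE a] [E.IsStrictlyLE b] (hE : ∀ i, IsFiniteLocallyFree (E.X i)),
      letI := HasDerivedCategory.standard Y.left.Modules
      letI := HasDerivedCategory.standard Y'.left.Modules
      HomComplex.IsISemiregularC Y E a b hE {q | q + 1 ∈ I} →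
        HomComplex.IsISemiregularC Y' (((Scheme.Modules.pullback e.hom.left).mapHomologicalComplex _).obj E) a b
          (fun i => (hE i).pullback e.hom.left) {q | q + 1 ∈ I})
    (h : gluableSigmaAdmissible n Y I E) :
    gluableSigmaAdmissible n Y' I (((Scheme.Modules.pullback e.hom.left).mapHomologicalComplex _).obj E) := by
  obtain ⟨hI, hneg, a, b, hGE, hLE, hE, hσ⟩ := h
  haveI := hGE; haveI := hLE
  exact ⟨hI, extRank_neg_vanish_pullback e E hneg, a, b, inferInstance, inferInstance,
    fun i => (hE i).pullback e.hom.left, hσC a b hE hσ⟩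

/-- **The displayed shape: `hσ` of road b02's `twistedDoor_respectsIso_of_sigmaPullback` FROM the σ_q-level statement alone.**
If Buchweitz–Flenner joint injectivity `IsISemiregularC` transports along pull-back by every isomorphism of `ℂ`-schemes
(hypothesis `hσC` — verbatim the signature of the missing `HomComplex.IsISemiregularC.of_schemeIso`, pull-back form), then so does
the gluable σ-notion, on bounded complexes of vector bundles: `∀ n ⦃Y Y'⦄ (e : Y' ≅ Y) I E, IsBoundedVBComplex E →
gluableSigmaAdmissible n Y I E → gluableSigmaAdmissible n Y' I (e^* E)`. [cite: BuchweitzFlenner2003, Def. 4.1 and §5 (I-semiregular)]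
[cite: Lieblich2006, Prop. 2.1.9] -/
theorem gluableSigmaAdmissible_pullback_of_schemeIso_of_isISemiregularC
    (hσC : ∀ ⦃Y Y' : SchemeOver ℂ⦄ (e : Y' ≅ Y) (E : CochainComplex Y.left.Modules ℤ) (a b : ℤ)
      [E.IsStrictlyGE a] [E.IsStrictlyLE b] (hE : ∀ i, IsFiniteLocallyFree (E.X i)) (J : Set ℕ),
      letI := HasDerivedCategory.standard Y.left.Modules
      letI := HasDerivedCategory.standard Y'.left.Modules
      HomComplex.IsISemiregularC Y E a b hE J →
        HomComplex.IsISemiregularC Y' (((Scheme.Modules.pullback e.hom.left).mapHomologicalComplex _).obj E) a b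
          (fun i => (hE i).pullback e.hom.left) J) :
    ∀ (n : ℕ) ⦃Y Y' : SchemeOver ℂ⦄ (e : Y' ≅ Y) (I : Finset ℕ) (E : CochainComplex Y.left.Modules ℤ),
      IsBoundedVBComplex E → gluableSigmaAdmissible n Y I E →
        gluableSigmaAdmissible n Y' I (((Scheme.Modules.pullback e.hom.left).mapHomologicalComplex _).obj E) :=
  fun _ _ _ e I E _ h => h.pullback_of_schemeIso_of_isISemiregularC e fun a b _ _ hE => hσC e E a b hE {q | q + 1 ∈ I}

end Reduction

end Summit.Ventures.HSemireg

end
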